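import Summits.QuantumFields.YangMills.Theorems.BalabanUVNodesN19TargetNotLawSummableSharp
import Mathlib.Analysis.Normed.Group.FunctionSeries

/-!
# YM-DAG node N19 (= NE7 proper) — TOOLS FOR ONE FIXED OBSERVABLE: the lacunary series test `Σ_j 8^{−(j+1)} G_j`, the lacunary lower bound,
# and the affordability of a level for exponentially many steps

Cell `pub-ymgap`, HUMAN RULING D-0062 (Track A) ∕ D-0149 (work-bound push), R141 (C) wider-strategy seat `pub-ymgap-dag-n19-e` (strategy s3 =
ALTERNATIVE CURRENCY), generation g23, module 5 (lineage module 82).  Route `Summits/QuantumFields/YangMills/Theses/BalabanUVNodes.lean` rev 25,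
cluster item K3⁷ «SpineGivenEndpointR13SepCoPH» (stmt-QuantumFields-20544); filed `--supports` that item `--as helper` (it proves no registered
stub).  COUNT-NEUTRAL: [folklore] real analysis over Mathlib (`continuous_tsum`, `integral_tsum_of_summable_integral_norm`, `sum_add_tsum_nat_add`,
geometric series) + module 73 `…N19TargetNotLawSummableSharp` (`pow_div_factorial_le_exp_mul_pow`) BY NAME; no measure of the lineage, no scheme object,
no Theses import; NOT a discharge claim.  These are the three tools of the sibling `…N19TargetFixedTestNotSummable` (ONE fixed Lipschitz observable with
NON-summable expectation increments under N19's `Target` at geometric remainders): §1 the SERIES TEST `g(x) = Σ_j 8^{−(j+1)}·G_j(x)` of uniformly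
bounded (`|G_j| ≤ 1`) continuous pieces — continuous (Weierstrass M-test), `(1∕7)`-Lipschitz on `[−1,1]` when every `G_j` is `1`-Lipschitz there,
`(1∕7)`-bounded, and integrated TERMWISE against every finite measure (`∫g dμ = Σ_j 8^{−(j+1)}∫G_j dμ`); §2 the LACUNARY LOWER BOUND: if `a_j = 0`
for `j < i`, `a_i = 1∕(2M)` and `|a_j| ≤ 1∕M` for `j > i`, then `|Σ_j 8^{−(j+1)}a_j| ≥ 8^{−(i+1)}∕(3M)` (head `8^{−(i+1)}∕(2M)`, tail `≤ 8^{−(i+1)}∕(7M)`);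
§3 AFFORDABILITY: for `0 < θ < 1`, `κ > 0`, `A ≥ 1` and all `B, M` there is a level `m ≥ M` whose window step cost `4e^{l₀}·l₀^{m−1}∕(m−1)!` is
`≤ κ·θ^{B + A·m}` — a level stays affordable under a geometric budget for `A·m` further steps after `B` steps, for every rate `A` (module 73's
`l₀^k∕k! ≤ e^{l₀∕t²}t^{2k}` at `t = θ^A`).

HONEST FRAMING (binding).  Elementary and [folklore]; NO consumer in the DAG today; nothing of Bałaban's instantiated; NE7 NOT PRINTED, NOT proved; N19
NOT discharged; count-neutral.  One finite `T⁴` programme at fixed `ε`; nothing continuum ∕ `ℝ⁴` ∕ OS ∕ mass-gap ∕ Clay.  0 `def` ∕ 0 `sorry`.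
-/

noncomputable section

open Real Finset MeasureTheory

namespace Summit.QuantumFields.YangMills.Theorems.BalabanUVNodesN19LacunaryTestSeries

open Summit.QuantumFields.YangMills.Theorems.BalabanUVNodesN19TargetNotLawSummableSharp (pow_div_factorial_le_exp_mul_pow)

/-! ## §1 The lacunary series test [folklore] -/

/-- The weights `8^{−(j+1)}` are summable. [folklore] -/
theorem summable_weights : Summable fun j : ℕ => (1 / 8 : ℝ) ^ (j + 1) := by
  simp_rw [pow_succ]
  exact (summable_geometric_of_lt_one (by norm_num) (by norm_num)).mul_right _

/-- `Σ_j 8^{−(j+1)} = 1∕7`. [folklore] -/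
theorem tsum_weights : ∑' j : ℕ, (1 / 8 : ℝ) ^ (j + 1) = 1 / 7 := by
  simp_rw [pow_succ]
  rw [tsum_mul_right, tsum_geometric_of_lt_one (by norm_num) (by norm_num)]
  norm_num

section Series

variable {G : ℕ → ℝ → ℝ}

/-- The terms of the series test are dominated by the weights. [folklore] -/
theorem norm_term_le (hB : ∀ j x, |G j x| ≤ 1) (j : ℕ) (x : ℝ) : ‖(1 / 8 : ℝ) ^ (j + 1) * G j x‖ ≤ (1 / 8 : ℝ) ^ (j + 1) := by
  rw [Real.norm_eq_abs, abs_mul, abs_of_pos (by positivity : (0 : ℝ) < (1 / 8 : ℝ) ^ (j + 1))]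
  exact mul_le_of_le_one_right (by positivity) (hB j x)

/-- The series test is summable at every point. [folklore] -/
theorem summable_seriesTest_at (hB : ∀ j x, |G j x| ≤ 1) (x : ℝ) : Summable fun j : ℕ => (1 / 8 : ℝ) ^ (j + 1) * G j x :=
  Summable.of_norm_bounded summable_weights (fun j => norm_term_le hB j x)

/-- ★ The series test is CONTINUOUS (Weierstrass M-test). [folklore] -/
theorem continuous_seriesTest (hG : ∀ j, Continuous (G j)) (hB : ∀ j x, |G j x| ≤ 1) :
    Continuous fun x => ∑' j : ℕ, (1 / 8 : ℝ) ^ (j + 1) * G j x :=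
  continuous_tsum (fun j => continuous_const.mul (hG j)) summable_weights (fun j x => norm_term_le hB j x)

/-- ★ The series test is `(1∕7)`-BOUNDED. [folklore] -/
theorem abs_seriesTest_le (hB : ∀ j x, |G j x| ≤ 1) (x : ℝ) : |∑' j : ℕ, (1 / 8 : ℝ) ^ (j + 1) * G j x| ≤ 1 / 7 := by
  rw [← Real.norm_eq_abs, ← tsum_weights]
  exact tsum_of_norm_bounded summable_weights.hasSum (fun j => norm_term_le hB j x)

/-- ★ The series test is `(1∕7)`-LIPSCHITZ on `[−1,1]` when every piece is `1`-Lipschitz there. [folklore] -/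
theorem abs_seriesTest_sub_le (hB : ∀ j x, |G j x| ≤ 1)
    (hL : ∀ (j : ℕ) (x y : ℝ), x ∈ Set.Icc (-1 : ℝ) 1 → y ∈ Set.Icc (-1 : ℝ) 1 → |G j x - G j y| ≤ 1 * |x - y|)
    {x y : ℝ} (hx : x ∈ Set.Icc (-1 : ℝ) 1) (hy : y ∈ Set.Icc (-1 : ℝ) 1) :
    |∑' j : ℕ, (1 / 8 : ℝ) ^ (j + 1) * G j x - ∑' j : ℕ, (1 / 8 : ℝ) ^ (j + 1) * G j y| ≤ 1 / 7 * |x - y| := by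
  rw [← (summable_seriesTest_at hB x).tsum_sub (summable_seriesTest_at hB y)]
  have hterm : ∀ j : ℕ, ‖(1 / 8 : ℝ) ^ (j + 1) * G j x - (1 / 8 : ℝ) ^ (j + 1) * G j y‖ ≤ (1 / 8 : ℝ) ^ (j + 1) * |x - y| := fun j => by
    rw [← mul_sub, Real.norm_eq_abs, abs_mul, abs_of_pos (by positivity : (0 : ℝ) < (1 / 8 : ℝ) ^ (j + 1))]
    exact mul_le_mul_of_nonneg_left (by simpa only [one_mul] using hL j x y hx hy) (by positivity)
  rw [← Real.norm_eq_abs, show 1 / 7 * |x - y| = ∑' j : ℕ, (1 / 8 : ℝ) ^ (j + 1) * |x - y| by rw [tsum_mul_right, tsum_weights]]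
  exact tsum_of_norm_bounded (summable_weights.mul_right _).hasSum hterm

/-- ★ The series test integrates TERMWISE against every finite measure: `∫ Σ_j 8^{−(j+1)}G_j dμ = Σ_j 8^{−(j+1)} ∫G_j dμ`. [folklore] -/
theorem integral_seriesTest (μ : Measure ℝ) [IsFiniteMeasure μ] (hG : ∀ j, Continuous (G j)) (hB : ∀ j x, |G j x| ≤ 1) :
    ∫ x, (∑' j : ℕ, (1 / 8 : ℝ) ^ (j + 1) * G j x) ∂μ = ∑' j : ℕ, (1 / 8 : ℝ) ^ (j + 1) * ∫ x, G j x ∂μ := by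
  have hint : ∀ j : ℕ, Integrable (fun x => (1 / 8 : ℝ) ^ (j + 1) * G j x) μ := fun j =>
    (integrable_const ((1 / 8 : ℝ) ^ (j + 1))).mono' ((continuous_const.mul (hG j)).aestronglyMeasurable)
      (Filter.Eventually.of_forall fun x => norm_term_le hB j x)
  have hsum : Summable fun j : ℕ => ∫ x, ‖(1 / 8 : ℝ) ^ (j + 1) * G j x‖ ∂μ := by
    refine Summable.of_nonneg_of_le (fun j => integral_nonneg fun x => norm_nonneg _)
      (fun j => ?_) (summable_weights.mul_right (μ.real Set.univ))
    have h := integral_mono_of_nonneg (μ := μ) (Filter.Eventually.of_forall fun x => norm_nonneg ((1 / 8 : ℝ) ^ (j + 1) * G j x))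
      (integrable_const ((1 / 8 : ℝ) ^ (j + 1))) (Filter.Eventually.of_forall fun x => norm_term_le hB j x)
    simpa only [integral_const, smul_eq_mul, mul_comm] using h
  rw [← integral_tsum_of_summable_integral_norm hint hsum]
  exact tsum_congr fun j => integral_const_mul _ _

end Series

/-! ## §2 The lacunary lower bound [folklore] -/

/-- ★ **THE LACUNARY LOWER BOUND.**  If `a_j = 0` for `j < i`, `a_i = 1∕(2M)` and `|a_j| ≤ 1∕M` for `j > i` (`M > 0`), then
`|Σ_j 8^{−(j+1)} a_j| ≥ 8^{−(i+1)}∕(3M)` (the head is `8^{−(i+1)}∕(2M)`, the tail at most `Σ_{j>i} 8^{−(j+1)}∕M = 8^{−(i+1)}∕(7M)`). [folklore] -/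
theorem lacunary_lower_bound {a : ℕ → ℝ} {i : ℕ} {M : ℝ} (hM : 0 < M) (hzero : ∀ j, j < i → a j = 0) (hmain : a i = 1 / (2 * M))
    (htail : ∀ j, i < j → |a j| ≤ 1 / M) :
    (1 / 8 : ℝ) ^ (i + 1) / (3 * M) ≤ |∑' j : ℕ, (1 / 8 : ℝ) ^ (j + 1) * a j| := by
  have hall : ∀ j, |a j| ≤ 1 / M := fun j => by
    rcases lt_trichotomy j i with h | h | h
    · rw [hzero j h, abs_zero]; positivity
    · rw [h, hmain, abs_of_pos (by positivity)]
      exact one_div_le_one_div_of_le hM (by linarith)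
    · exact htail j h
  have hsum : Summable fun j : ℕ => (1 / 8 : ℝ) ^ (j + 1) * a j :=
    Summable.of_norm_bounded (summable_weights.mul_right (1 / M)) fun j => by
      rw [Real.norm_eq_abs, abs_mul, abs_of_pos (by positivity : (0 : ℝ) < (1 / 8 : ℝ) ^ (j + 1))]
      exact mul_le_mul_of_nonneg_left (hall j) (by positivity)
  -- head + tail
  rw [← hsum.sum_add_tsum_nat_add (i + 1)]
  have hhead : ∑ j ∈ range (i + 1), (1 / 8 : ℝ) ^ (j + 1) * a j = (1 / 8 : ℝ) ^ (i + 1) * (1 / (2 * M)) := by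
    rw [Finset.sum_range_succ, hmain, Finset.sum_eq_zero fun j hj => by rw [hzero j (Finset.mem_range.1 hj), mul_zero], zero_add]
  have htail' : ‖∑' j : ℕ, (1 / 8 : ℝ) ^ (j + (i + 1) + 1) * a (j + (i + 1))‖ ≤ (1 / 8 : ℝ) ^ (i + 1) * (1 / (7 * M)) := by
    have hw : HasSum (fun j : ℕ => (1 / 8 : ℝ) ^ (i + 1) * ((1 / 8 : ℝ) ^ (j + 1) * (1 / M))) ((1 / 8 : ℝ) ^ (i + 1) * (1 / (7 * M))) := by
      have h := (summable_weights.mul_right (1 / M)).hasSum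
      rw [tsum_mul_right, tsum_weights] at h
      have e : (1 / 7 : ℝ) * (1 / M) = 1 / (7 * M) := by rw [one_div_mul_one_div]
      rw [e] at h
      exact h.mul_left _
    refine tsum_of_norm_bounded hw fun j => ?_
    rw [Real.norm_eq_abs, abs_mul, abs_of_pos (by positivity : (0 : ℝ) < (1 / 8 : ℝ) ^ (j + (i + 1) + 1)),
      show (1 / 8 : ℝ) ^ (j + (i + 1) + 1) = (1 / 8 : ℝ) ^ (i + 1) * (1 / 8 : ℝ) ^ (j + 1) by rw [← pow_add]; ring_nf]
    rw [mul_assoc]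
    exact mul_le_mul_of_nonneg_left (mul_le_mul_of_nonneg_left (htail _ (by omega)) (by positivity)) (by positivity)
  rw [Real.norm_eq_abs] at htail'
  rw [hhead]
  have hpos : (0 : ℝ) < (1 / 8 : ℝ) ^ (i + 1) := by positivity
  -- `|h + t| ≥ h − |t| ≥ 8^{−(i+1)}(1∕(2M) − 1∕(7M)) ≥ 8^{−(i+1)}∕(3M)`
  have h1 : (1 / 8 : ℝ) ^ (i + 1) * (1 / (2 * M)) - (1 / 8 : ℝ) ^ (i + 1) * (1 / (7 * M)) ≤
      |(1 / 8 : ℝ) ^ (i + 1) * (1 / (2 * M)) + ∑' j : ℕ, (1 / 8 : ℝ) ^ (j + (i + 1) + 1) * a (j + (i + 1))| := by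
    have := abs_add_le ((1 / 8 : ℝ) ^ (i + 1) * (1 / (2 * M)) + ∑' j : ℕ, (1 / 8 : ℝ) ^ (j + (i + 1) + 1) * a (j + (i + 1)))
      (-(∑' j : ℕ, (1 / 8 : ℝ) ^ (j + (i + 1) + 1) * a (j + (i + 1))))
    rw [add_neg_cancel_right, abs_neg, abs_of_pos (by positivity : (0 : ℝ) < (1 / 8 : ℝ) ^ (i + 1) * (1 / (2 * M)))] at this
    linarith
  have h2 : (1 / 8 : ℝ) ^ (i + 1) / (3 * M) ≤ (1 / 8 : ℝ) ^ (i + 1) * (1 / (2 * M)) - (1 / 8 : ℝ) ^ (i + 1) * (1 / (7 * M)) := by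
    rw [← mul_sub, div_eq_mul_one_div]
    refine mul_le_mul_of_nonneg_left ?_ hpos.le
    rw [div_sub_div _ _ (by positivity) (by positivity), div_le_div_iff₀ (by positivity) (by positivity)]
    nlinarith
  exact h2.trans h1

/-! ## §3 A level stays affordable for exponentially many steps under a geometric budget [folklore] -/

/-- ★ **AFFORDABILITY.**  `0 ≤ l₀`, `κ > 0`, `0 < θ < 1`, a rate `A ≥ 1`, an offset `B` and a floor `M`: there is a level `m ≥ M` with
`4e^{l₀}·l₀^{m−1}∕(m−1)! ≤ κ·θ^{B + A·m}` (module 73's `l₀^k∕k! ≤ e^{l₀∕t²}t^{2k}` at `t = θ^A`; `m = M + B + n₀ + 2` with `θ^{n₀}` below the constant).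
[folklore] -/
theorem exists_level_affordable {l₀ κ θ : ℝ} (hl₀ : 0 ≤ l₀) (hκ : 0 < κ) (hθ0 : 0 < θ) (hθ1 : θ < 1) {A : ℕ} (hA : 1 ≤ A) (B M : ℕ) :
    ∃ m : ℕ, M ≤ m ∧ 4 * Real.exp l₀ * (l₀ ^ (m - 1) / ((m - 1).factorial : ℝ)) ≤ κ * θ ^ (B + A * m) := by
  set t : ℝ := θ ^ A with ht
  have ht0 : 0 < t := by positivity
  set D : ℝ := 4 * Real.exp l₀ * Real.exp (l₀ / t ^ 2) with hD
  have hD0 : 0 < D := by positivity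
  obtain ⟨n₀, hn₀⟩ := exists_pow_lt_of_lt_one (div_pos hκ hD0) hθ1
  refine ⟨M + B + n₀ + 2, by omega, ?_⟩
  have e1 : M + B + n₀ + 2 - 1 = M + B + n₀ + 1 := by omega
  rw [e1]
  have hfac := pow_div_factorial_le_exp_mul_pow hl₀ ht0 (M + B + n₀ + 1)
  -- the exponent comparison: `B + A(M+B+n₀+2) + n₀ ≤ 2A(M+B+n₀+1)` (`A ≥ 1`)
  have hexp : B + A * (M + B + n₀ + 2) + n₀ ≤ A * (2 * (M + B + n₀ + 1)) := by nlinarith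
  have hpow : t ^ (2 * (M + B + n₀ + 1)) ≤ θ ^ (B + A * (M + B + n₀ + 2)) * θ ^ n₀ := by
    rw [ht, ← pow_mul, ← pow_add]
    exact pow_le_pow_of_le_one hθ0.le hθ1.le hexp
  calc 4 * Real.exp l₀ * (l₀ ^ (M + B + n₀ + 1) / ((M + B + n₀ + 1).factorial : ℝ))
      ≤ 4 * Real.exp l₀ * (Real.exp (l₀ / t ^ 2) * t ^ (2 * (M + B + n₀ + 1))) := mul_le_mul_of_nonneg_left hfac (by positivity)
    _ ≤ 4 * Real.exp l₀ * (Real.exp (l₀ / t ^ 2) * (θ ^ (B + A * (M + B + n₀ + 2)) * θ ^ n₀)) := by gcongr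
    _ = (D * θ ^ n₀) * θ ^ (B + A * (M + B + n₀ + 2)) := by rw [hD]; ring
    _ ≤ (D * (κ / D)) * θ ^ (B + A * (M + B + n₀ + 2)) :=
        mul_le_mul_of_nonneg_right (mul_le_mul_of_nonneg_left hn₀.le hD0.le) (by positivity)
    _ = κ * θ ^ (B + A * (M + B + n₀ + 2)) := by field_simp

end Summit.QuantumFields.YangMills.Theorems.BalabanUVNodesN19LacunaryTestSeries

end
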